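import Summits.BirchSwinnertonDyer.BirchSwinnertonDyer.Theorems.ByReductionTypeAtTwoOrdKatoHalfAtTwoIsoHCEngine
import Literature.NumberTheory.EllipticCurves.CyclotomicZpExtensionLayerOneSqrtTwoProofs
import Literature.NumberTheory.EllipticCurves.TwoAdicImageGoodOrdinaryAtTwoProofs
import HarnessLib

/-!
# Route ByReductionTypeAtTwo, crux `OrdKatoHalfAtTwoIso` (stmt-BirchSwinnertonDyer-19573), child B8
# `OrdKatoIntSurjectiveAtTwo` (stmt-BirchSwinnertonDyer-23762): a TRANSPOSITION of `E[2]` inside `Gal(ℚ̄/ℚ_∞)` for the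
# CYCLOTOMIC `ℤ₂`-extension — for EITHER sign of `Δ` — and the Steinberg–Sah toolkit off the `Δ < 0` hypothesis

Seat `cruxlead-stmt-BirchSwinnertonDyer-19573-w2` (prover WIDTH under the LEAD cruxlead-19573 g4, line
`steinberg-fibre-at-two`; HOME `run/shared/lean/pub/bsd-2adic/`; `--supports` stmt-BirchSwinnertonDyer-23762). HONEST FRAMING
(cell bsd-2adic): BSD is not proved by any of this; neither the crux nor the child B8 is proved here; theorems only (no
definition, no named fact, no `sorry`).

WHY THIS FILE. After the lead's re-cut (p678187 `…ZetaColemanMuDefs`, p678698 `…ZetaColemanMuDoor`) the child B8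
(`KatoIntAtGoodOrdSurjectiveTwo`: Kato's lower divisibility at a good ordinary `2` for `ρ_{W,2^∞}` onto) is load-bearing only
on `0 < Δ_W`, because the kernel chain «re-cut socket 2 ⇒ `μ(X(E/ℚ_∞)) = 0` ⇒ B8's conclusion» consumes SOCKET 1
(`coreTheoremATwoResidue_holds`, p669276), whose three inputs T1 (`SelmerSideTwo`), Ω1 = (H-C) `ChebotarevTranspositionTwo`,
Ω2 = (H-K) `KolyvaginRankOneTwo` are stated for `Δ_W < 0`. In Ω1 and in the whole Steinberg–Sah toolkit of the line
(`…SteinbergSahResidue`, `…HCEngine` §3) the sign of `Δ` enters at EXACTLY ONE point: complex conjugation is an element of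
`ker κ = Gal(ℚ̄/ℚ_∞)` that is a TRANSPOSITION on `E[2]` when `Δ < 0` (and is trivial on `E[2]` when `Δ > 0`). This file
removes that point for the cyclotomic tower:

* §1 parity bookkeeping in `Γ = Gal(ℚ_∞/ℚ) ≅ ℤ₂`: the first layer `κ⁻¹(2ℤ₂) = Gal(ℚ̄/ℚ_1)` has index `2`
  (`mul_mem_layerSubgroup_one_of_not_mem`) and `Gal(ℚ̄/ℚ_1) = ker κ · {squares}`
  (`exists_mem_kerSubgroup_mul_sq_of_mem_layerSubgroup_one`).
* §2 `exists_mem_kerSubgroup_sign_permGal_eq_neg_one_of_isCyclotomic` — **for `κ` CYCLOTOMIC, `ρ̄_{W,2}` onto and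
  `2Δ_W ∉ ℚ^{×2}`, some `τ ∈ ker κ` is a transposition on `E[2]`.** Proof: otherwise `sgn ∘ ρ̄₂` is trivial on `ker κ`,
  hence on `Gal(ℚ̄/ℚ_1)` (squares are even), hence — being onto `{±1}` — it is exactly the quadratic character of
  `ℚ_1 = ℚ(√2)` (tree: `ZpExtension.IsCyclotomic.exists_sq_eq_two_layer_one`, Washington §13.1); then `δ·√2`
  (`δ = √(Δ/16)`, `σδ = sgn(σ)δ`) is `Γ_ℚ`-fixed, i.e. rational (`K̄/ℚ` Galois), so `2Δ = (4·δ√2)² ∈ ℚ^{×2}`.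
  At a prime of GOOD reduction `2` the hypothesis `2Δ ∉ ℚ^{×2}` is automatic (`Δ_min` odd; tree
  `not_isSquare_two_mul_Δ_of_good_two`) — so on the WHOLE habitat of B8 (`0 < Δ` included) and of the crux.
  Corollaries: a `3`-cycle in `ker κ` (`exists_mem_kerSubgroup_noFixedPoint_of_isCyclotomic`, via p657099), the
  good-at-`2` forms.
* §3 the Steinberg–Sah statements of the line with `Δ < 0` REPLACED by «`κ` cyclotomic, `2Δ ∉ ℚ^{×2}`»: the untwisted
  vanishing form for `E[2]` (engine `SahRelNormal`, verbatim the argument of `…HCEngine` §3 from a fixed-point-free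
  `σ₀ ∈ ker κ`), and the three twisted forms through the line's `…_of_noFixedPoint` lemmas (p657595).

What this buys for B8 (next file of this seat): Ω1 (H-C) becomes provable on `0 < Δ`; of socket 1's inputs only Ω2 (H-K:
the real place in the reciprocity law, `H¹(ℝ, 𝒯_J) ≠ 0` when `Δ > 0`) keeps a sign hypothesis — the kernel locus of
MEMO-6's `c_∞ = 2`.

References: L. C. Washington, *Introduction to Cyclotomic Fields* (1997) §13.1 [Washington1997]; T. Dokchitser,
V. Dokchitser, Math. Z. 272 (2012) [DokchitserDokchitserMathZ2012]; C.-H. Sah, J. Algebra 10 (1968) Prop. 2.7 (b) [Sah1968];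
J.-P. Serre, Invent. Math. 15 (1972) §2.6 [Serre1972]; the line's helpers p656928, p657099, p657595, `…HCEngine`.
-/

set_option autoImplicit false
set_option linter.dupNamespace false

noncomputable section

open Field WeierstrassCurve Function
open Literature.NumberTheory.EllipticCurves Literature.NumberTheory.GaloisRepresentations
open Literature.NumberTheory.EllipticCurves.DokchitserDokchitser2012
open Summit.BirchSwinnertonDyer.BirchSwinnertonDyer.Rank1Residual

-- D-0017: single-problem summit, so `Summit.BirchSwinnertonDyer.BirchSwinnertonDyer.…` repeats a namespace BY DESIGN.
namespace Summit.BirchSwinnertonDyer.BirchSwinnertonDyer.Theorems.SteinbergFibreAtTwo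

/-! ## §1 Parity bookkeeping in `Gal(ℚ_∞/ℚ) ≅ ℤ₂`: the first layer -/

section Layer

variable (κ : ZpExtension ℚ 2)

/-- In `ℤ₂` the sum of two non-multiples of `2` is a multiple of `2` (residue field `𝔽₂`). [folklore] -/
private theorem two_dvd_add_of_not_two_dvd {a b : ℤ_[2]} (ha : ¬ ((2 : ℕ) : ℤ_[2]) ∣ a)
    (hb : ¬ ((2 : ℕ) : ℤ_[2]) ∣ b) : ((2 : ℕ) : ℤ_[2]) ∣ a + b := by
  have key : ∀ x : ℤ_[2], ((2 : ℕ) : ℤ_[2]) ∣ x ↔ PadicInt.toZMod x = 0 := fun x => by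
    rw [← Ideal.mem_span_singleton, ← PadicInt.maximalIdeal_eq_span_p, ← PadicInt.ker_toZMod,
      RingHom.mem_ker]
  rw [key] at ha hb ⊢
  rw [map_add]
  have h : ∀ u v : ZMod 2, u ≠ 0 → v ≠ 0 → u + v = 0 := by decide
  exact h _ _ ha hb

/-- **The first layer has index `2`**: if `σ, τ ∉ Gal(ℚ̄/ℚ_1) = κ⁻¹(2ℤ₂)` then `στ ∈ Gal(ℚ̄/ℚ_1)`
(`κ(στ) = κ σ + κ τ`, odd + odd = even). [cite: Washington1997, §13.1] -/
theorem mul_mem_layerSubgroup_one_of_not_mem {σ τ : absoluteGaloisGroup ℚ}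
    (hσ : σ ∉ κ.layerSubgroup 1) (hτ : τ ∉ κ.layerSubgroup 1) : σ * τ ∈ κ.layerSubgroup 1 := by
  rw [ZpExtension.mem_layerSubgroup, pow_one] at hσ hτ ⊢
  rw [map_mul, toAdd_mul]
  exact two_dvd_add_of_not_two_dvd hσ hτ

/-- **`Gal(ℚ̄/ℚ_1) = ker κ · Γ_ℚ²`**: an element of the first layer is `τ ρ²` with `τ ∈ ker κ` (`κ σ = 2y`, pick
`ρ` with `κ ρ = y` by surjectivity of `κ`). [cite: Washington1997, §13.1] -/
theorem exists_mem_kerSubgroup_mul_sq_of_mem_layerSubgroup_one {σ : absoluteGaloisGroup ℚ}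
    (hσ : σ ∈ κ.layerSubgroup 1) :
    ∃ τ ∈ κ.kerSubgroup, ∃ ρ : absoluteGaloisGroup ℚ, σ = τ * (ρ * ρ) := by
  rw [ZpExtension.mem_layerSubgroup, pow_one] at hσ
  obtain ⟨y, hy⟩ := hσ
  obtain ⟨ρ, hρ⟩ := κ.surjective (Multiplicative.ofAdd y)
  rw [ZpExtension.coe_toContinuousMonoidHom] at hρ
  refine ⟨σ * (ρ * ρ)⁻¹, ?_, ρ, by rw [inv_mul_cancel_right]⟩
  rw [ZpExtension.mem_kerSubgroup, map_mul κ, map_inv κ, map_mul κ, hρ]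
  apply Multiplicative.toAdd.injective
  rw [toAdd_mul, toAdd_inv, toAdd_mul, toAdd_ofAdd, hy, toAdd_one]
  push_cast
  ring

end Layer

/-! ## §2 A transposition of `E[2]` in `Gal(ℚ̄/ℚ_∞)` for the cyclotomic `ℤ₂`-extension, either sign of `Δ` -/

section Transposition

variable (W : WeierstrassCurve ℚ) [W.IsElliptic] (κ : ZpExtension ℚ 2)

/-- `2` is not a square in `ℚ`. [folklore] -/
private theorem not_isSquare_two_rat : ¬ IsSquare (2 : ℚ) := by
  simpa using not_isSquare_two_mul_intCast_of_odd (D := 1) odd_one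

/-- **A transposition of `E[2]` inside `Gal(ℚ̄/ℚ_∞^{cyc})`, for EITHER sign of `Δ`.** Let `W/ℚ` be elliptic with
`ρ̄_{W,2}` onto `GL₂(𝔽₂) ≅ S₃`, `2Δ_W ∉ ℚ^{×2}`, and `κ` the CYCLOTOMIC `ℤ₂`-extension of `ℚ`. Then some `τ ∈ ker κ`
induces an odd permutation (a transposition) of the three non-zero `2`-torsion points. Proof: if every element of
`ker κ` were even, then so would be every element of the first layer `Gal(ℚ̄/ℚ_1) = ker κ · Γ_ℚ²`; an odd element exists
(`ρ̄₂` onto), so `sgn ∘ ρ̄₂` would be the quadratic character of `ℚ_1`, which is `ℚ(√2)` (Washington §13.1; tree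
`IsCyclotomic.exists_sq_eq_two_layer_one`); with `σδ = sgn(σ)δ`, `16δ² = Δ` (Dokchitser–Dokchitser) the product `δ√2`
would be fixed by `Γ_ℚ`, i.e. rational, forcing `2Δ = (4δ√2)² ∈ ℚ^{×2}`. (For `Δ < 0` complex conjugation is such a
`τ`, p657370; the point here is `Δ > 0`.) [cite: Washington1997, §13.1] [cite: DokchitserDokchitserMathZ2012, Theorem (1), proof (ℚ(E[2]) ⊃ ℚ(√Δ))] -/
theorem exists_mem_kerSubgroup_sign_permGal_eq_neg_one_of_isCyclotomic (hκ : κ.IsCyclotomic)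
    (h2 : W.HasSurjectiveModNGaloisRep 2) (hΔ : ¬ IsSquare (2 * W.Δ)) :
    ∃ τ ∈ κ.kerSubgroup, Equiv.Perm.sign (permGal W (two_ne_zero : (2 : ℚ) ≠ 0) τ) = -1 := by
  have h2Q : (2 : ℚ) ≠ 0 := two_ne_zero
  by_contra hcon
  push Not at hcon
  have hker : ∀ τ ∈ κ.kerSubgroup, Equiv.Perm.sign (permGal W h2Q τ) = 1 := fun τ hτ =>
    (Int.units_eq_one_or _).resolve_right (hcon τ hτ)
  -- Step 1: every element of the first layer is even
  have hL1 : ∀ σ ∈ κ.layerSubgroup 1, Equiv.Perm.sign (permGal W h2Q σ) = 1 := by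
    intro σ hσ
    obtain ⟨τ, hτ, ρ, rfl⟩ := exists_mem_kerSubgroup_mul_sq_of_mem_layerSubgroup_one κ hσ
    rw [permGal_mul, permGal_mul, map_mul, map_mul, hker τ hτ, Int.units_mul_self, mul_one]
  -- an odd element exists (`ρ̄₂` onto), and it is not in the first layer
  obtain ⟨σ₁, hσ₁⟩ := permGal_surjective_of_hasSurjectiveModNGaloisRep_two W h2 (Equiv.swap 0 1)
  have hσ₁sign : Equiv.Perm.sign (permGal W h2Q σ₁) = -1 := by
    rw [hσ₁, Equiv.Perm.sign_swap (by decide)]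
  have hσ₁L : σ₁ ∉ κ.layerSubgroup 1 := fun h => by
    have h1 := hL1 σ₁ h
    rw [hσ₁sign] at h1
    exact absurd h1 (by decide)
  -- Step 2: every element off the first layer is odd
  have hodd : ∀ σ : absoluteGaloisGroup ℚ, σ ∉ κ.layerSubgroup 1 →
      Equiv.Perm.sign (permGal W h2Q σ) = -1 := by
    intro σ hσ
    have h1 := hL1 _ (mul_mem_layerSubgroup_one_of_not_mem κ hσ hσ₁L)
    rw [permGal_mul, map_mul, hσ₁sign] at h1
    rcases Int.units_eq_one_or (Equiv.Perm.sign (permGal W h2Q σ)) with h | h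
    · rw [h] at h1
      exact absurd h1 (by decide)
    · exact h
  -- `√2 ∈ ℚ_1`: the first layer fixes some `t` with `t² = 2`
  obtain ⟨⟨t, htmem⟩, ht2⟩ := ZpExtension.IsCyclotomic.exists_sq_eq_two_layer_one hκ
  have ht2' : t ^ 2 = 2 := by
    have h := congrArg (algebraMap (κ.layer 1) (AlgebraicClosure ℚ)) ht2
    rw [map_pow, map_ofNat] at h
    exact h
  have htfix : ∀ σ ∈ κ.layerSubgroup 1, σ • t = t := by
    intro σ hσ
    change t ∈ IntermediateField.fixedField _ at htmem
    rw [IntermediateField.mem_fixedField_iff] at htmem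
    exact htmem _ (Subgroup.mem_map_of_mem _ hσ)
  have h2fix : ∀ σ : absoluteGaloisGroup ℚ, σ • (2 : AlgebraicClosure ℚ) = 2 := fun σ => by
    rw [show (2 : AlgebraicClosure ℚ) = algebraMap ℚ (AlgebraicClosure ℚ) 2 from (map_ofNat _ 2).symm,
      smul_algebraMap]
  -- … and every element off the first layer negates `t` (else `t ∈ ℚ`, `2 ∈ ℚ^{×2}`)
  have htneg : ∀ σ : absoluteGaloisGroup ℚ, σ ∉ κ.layerSubgroup 1 → σ • t = -t := by
    intro σ hσ
    have hsq : (σ • t) ^ 2 = t ^ 2 := by rw [← smul_pow', ht2', h2fix]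
    rcases eq_or_eq_neg_of_sq_eq_sq _ _ hsq with h | h
    · exfalso
      have hinv : σ⁻¹ • t = t := by
        conv_lhs => rw [← h]
        rw [inv_smul_smul]
      have hall : ∀ g : absoluteGaloisGroup ℚ, g • t = t := by
        intro g
        by_cases hg : g ∈ κ.layerSubgroup 1
        · exact htfix g hg
        · calc g • t = (g * σ * σ⁻¹) • t := by rw [mul_inv_cancel_right]
            _ = (g * σ) • σ⁻¹ • t := mul_smul _ _ _
            _ = t := by rw [hinv, htfix _ (mul_mem_layerSubgroup_one_of_not_mem κ hg hσ)]
      obtain ⟨q, hq⟩ := (InfiniteGalois.mem_range_algebraMap_iff_fixed t).mpr fun g => hall g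
      rw [eq_ratCast] at hq
      apply not_isSquare_two_rat
      refine ⟨q, ?_⟩
      have hqq : ((q * q : ℚ) : AlgebraicClosure ℚ) = ((2 : ℚ) : AlgebraicClosure ℚ) := by
        push_cast
        rw [hq, ← pow_two, ht2']
      exact_mod_cast hqq.symm
    · exact h
  -- hence `δ·t` is fixed by all of `Γ_ℚ`, i.e. rational
  have hfix : ∀ g : absoluteGaloisGroup ℚ, g • (delta W h2Q * t) = delta W h2Q * t := by
    intro g
    rw [smul_mul', smul_delta]
    by_cases hg : g ∈ κ.layerSubgroup 1
    · rw [hL1 g hg, htfix g hg, Units.val_one, Int.cast_one, one_mul]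
    · rw [hodd g hg, htneg g hg, Units.val_neg, Units.val_one, Int.cast_neg, Int.cast_one]
      ring
  obtain ⟨q, hq⟩ := (InfiniteGalois.mem_range_algebraMap_iff_fixed (delta W h2Q * t)).mpr fun g => hfix g
  rw [eq_ratCast] at hq
  -- so `2Δ = (4 δ t)²` is a rational square
  have hΔ' := algebraMap_Δ W h2Q
  rw [eq_ratCast] at hΔ'
  apply hΔ
  refine ⟨4 * q, ?_⟩
  have hqq : (((4 * q) * (4 * q) : ℚ) : AlgebraicClosure ℚ) = ((2 * W.Δ : ℚ) : AlgebraicClosure ℚ) := by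
    push_cast
    rw [hq, hΔ']
    linear_combination ((16 : AlgebraicClosure ℚ) * delta W h2Q ^ 2) * ht2'
  exact_mod_cast hqq.symm

/-- **Consumer shape: an element of `Gal(ℚ̄/ℚ_∞^{cyc})` moving a `2`-torsion point by a transposition** — the
sign-free replacement of the pair (`ZpExtension.mem_kerSubgroup_of_isComplexConjugation`,
`sign_permGal_eq_neg_one_of_isComplexConjugation_of_Δ_neg` / `exists_smul_ne_of_isComplexConjugation_of_Δ_neg`) used
by the line on `Δ < 0`. [cite: Washington1997, §13.1] [cite: SilvermanAEC2009, III.§7 (the representation G_{K̄/K} → Aut(E[m]))] -/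
theorem exists_mem_kerSubgroup_transposition_of_isCyclotomic (hκ : κ.IsCyclotomic)
    (h2 : W.HasSurjectiveModNGaloisRep 2) (hΔ : ¬ IsSquare (2 * W.Δ)) :
    ∃ τ ∈ κ.kerSubgroup, Equiv.Perm.sign (permGal W (two_ne_zero : (2 : ℚ) ≠ 0) τ) = -1 ∧
      ∃ P : geomTorsion W 2, τ • P ≠ P := by
  obtain ⟨τ, hτ, hsign⟩ := exists_mem_kerSubgroup_sign_permGal_eq_neg_one_of_isCyclotomic W κ hκ h2 hΔ
  have hne : permGal W two_ne_zero τ ≠ 1 := by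
    intro h
    rw [h, Equiv.Perm.sign_one] at hsign
    exact absurd hsign (by decide)
  obtain ⟨i, hi⟩ : ∃ i : Fin 3, permGal W two_ne_zero τ i ≠ i := by
    by_contra h
    exact hne (Equiv.ext fun i ↦ not_not.mp (not_exists.mp h i))
  exact ⟨τ, hτ, hsign, T W two_ne_zero i, fun h ↦
    hi (T_injective W two_ne_zero ((T_permGal W two_ne_zero τ i).trans h))⟩

/-- **A `3`-cycle in `Gal(ℚ̄/ℚ_∞^{cyc})`, either sign of `Δ`**: for `κ` cyclotomic, `ρ̄_{W,2}` onto and `2Δ ∉ ℚ^{×2}`,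
some `σ₀ ∈ ker κ` fixes no non-zero `2`-torsion point (a normal subgroup of `S₃` containing a transposition is `S₃`,
p657099). Sign-free replacement of `exists_mem_kerSubgroup_noFixedPoint_of_residue`.
[cite: SilvermanAEC2009, III.§7] [cite: Washington1997, §13.1] -/
theorem exists_mem_kerSubgroup_noFixedPoint_of_isCyclotomic (hκ : κ.IsCyclotomic)
    (h2 : W.HasSurjectiveModNGaloisRep 2) (hΔ : ¬ IsSquare (2 * W.Δ)) :
    ∃ σ₀ ∈ κ.kerSubgroup, ∀ P : geomTorsion W 2, P ≠ 0 → σ₀ • P ≠ P := by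
  obtain ⟨τ, hτ, hsign⟩ := exists_mem_kerSubgroup_sign_permGal_eq_neg_one_of_isCyclotomic W κ hκ h2 hΔ
  exact exists_mem_kerSubgroup_forall_smul_ne W κ h2 hτ hsign

/-- **At a prime of GOOD reduction `2` the hypothesis `2Δ ∉ ℚ^{×2}` is automatic** (`Δ = Δ_min` is odd): for a
globally minimal `W`, good at `2`, with `ρ̄_{W,2}` onto and `κ` cyclotomic, `ker κ` contains a transposition of
`E[2]` — on the whole habitat of the crux `OrdKatoHalfAtTwoIso` and of its child B8, both signs of `Δ`.
[cite: DokchitserDokchitserMathZ2012, Theorem (3)] [cite: Washington1997, §13.1] -/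
theorem exists_mem_kerSubgroup_sign_permGal_eq_neg_one_of_good_two [W.IsGloballyMinimal]
    (hκ : κ.IsCyclotomic) (hgood : W.HasGoodReductionAtPrime 2) (h2 : W.HasSurjectiveModNGaloisRep 2) :
    ∃ τ ∈ κ.kerSubgroup, Equiv.Perm.sign (permGal W (two_ne_zero : (2 : ℚ) ≠ 0) τ) = -1 :=
  exists_mem_kerSubgroup_sign_permGal_eq_neg_one_of_isCyclotomic W κ hκ h2
    (not_isSquare_two_mul_Δ_of_good_two W hgood).1

/-- **A `3`-cycle in `Gal(ℚ̄/ℚ_∞^{cyc})` at a good `2`**, globally minimal `W`, `ρ̄_{W,2}` onto, either sign of `Δ`.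
[cite: DokchitserDokchitserMathZ2012, Theorem (3)] [cite: SilvermanAEC2009, III.§7] -/
theorem exists_mem_kerSubgroup_noFixedPoint_of_good_two [W.IsGloballyMinimal] (hκ : κ.IsCyclotomic)
    (hgood : W.HasGoodReductionAtPrime 2) (h2 : W.HasSurjectiveModNGaloisRep 2) :
    ∃ σ₀ ∈ κ.kerSubgroup, ∀ P : geomTorsion W 2, P ≠ 0 → σ₀ • P ≠ P :=
  exists_mem_kerSubgroup_noFixedPoint_of_isCyclotomic W κ hκ h2 (not_isSquare_two_mul_Δ_of_good_two W hgood).1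

end Transposition

/-! ## §3 The Steinberg–Sah toolkit of the line with `Δ < 0` replaced by «`κ` cyclotomic, `2Δ ∉ ℚ^{×2}`» -/

section Sah

variable (W : WeierstrassCurve ℚ) [W.IsElliptic] (κ : ZpExtension ℚ 2)

/-- **Steinberg–Sah for the UNTWISTED module `E[2]`, vanishing form, from a fixed-point-free `σ₀ ∈ ker κ`**: a
continuous 1-cocycle of `Γ_ℚ` in `E[2]` vanishing on `ker ρ̄_{E,2} ⊓ ker κ` has zero class. Verbatim the argument of
`torsion_two_oneCocycleClass_eq_zero_of_forall_mem_eq_zero_of_residue` (`…HCEngine` §3: engine `SahRelNormal` with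
`H = ker(sgn ∘ permGal)`, `z = σ₀`), with the 3-cycle taken as a hypothesis instead of produced from `Δ < 0`.
[cite: Sah1968, Prop. 2.7 (b) and its proof, p. 60] [cite: Serre1972, §2.6] -/
theorem torsion_two_oneCocycleClass_eq_zero_of_forall_mem_eq_zero_of_noFixedPoint {σ₀ : absoluteGaloisGroup ℚ}
    (hκ : σ₀ ∈ κ.kerSubgroup) (hσ₀ : ∀ P : geomTorsion W 2, P ≠ 0 → σ₀ • P ≠ P)
    (δ : contOneCocycles (W.torsionGaloisModule (2 : ℤ)).toTopRep)
    (hN : ∀ ν ∈ (galoisRepTorsion W 2).ker ⊓ κ.kerSubgroup, δ.1 ν = 0) :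
    oneCocycleClass _ δ = 0 := by
  have h2Q : (2 : ℚ) ≠ 0 := two_ne_zero
  -- `H = ker (sgn ∘ permGal)`, a normal subgroup containing `N` and the 3-cycle `σ₀`
  let πG : absoluteGaloisGroup ℚ →* Equiv.Perm (Fin 3) :=
    { toFun := permGal W h2Q, map_one' := permGal_one W h2Q, map_mul' := permGal_mul W h2Q }
  let H : Subgroup (absoluteGaloisGroup ℚ) := (Equiv.Perm.sign.comp πG).ker
  have hHmem : ∀ g, g ∈ H ↔ Equiv.Perm.sign (permGal W h2Q g) = 1 := fun g => by
    change (Equiv.Perm.sign.comp πG) g = 1 ↔ _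
    rfl
  have hHnormal : H.Normal := MonoidHom.normal_ker _
  have hσ₀T : ∀ i, permGal W h2Q σ₀ i ≠ i := by
    intro i hi
    have hT : σ₀ • T W h2Q i = T W h2Q i := by rw [← T_permGal, hi]
    exact hσ₀ (T W h2Q i) (fun h0 => coe_T_ne_zero W h2Q i (by rw [h0]; rfl)) hT
  have hσ₀H : σ₀ ∈ H := (hHmem σ₀).mpr (perm_fin_three_sign_eq_one_of_forall_ne _ hσ₀T)
  have hNH : (galoisRepTorsion W 2).ker ⊓ κ.kerSubgroup ≤ H := by
    intro ν hν
    have hν1 : permGal W h2Q ν = 1 :=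
      (forall_smul_eq_iff_permGal_eq_one W ν).mp
        ((mem_ker_galoisRepTorsion_two_iff W ν).mp (Subgroup.mem_inf.mp hν).1)
    rw [hHmem, hν1, map_one]
  -- `σ₀` commutes with `H` on `E[2]`, hence is central in `H` modulo `N`
  have hcommE : ∀ h ∈ H, ∀ P : geomTorsion W 2, σ₀ • h • P = h • σ₀ • P := by
    intro h hh P
    have hperm : permGal W h2Q (σ₀ * h) = permGal W h2Q (h * σ₀) := by
      rw [permGal_mul, permGal_mul]
      exact perm_fin_three_comm_of_sign_eq_one _ _ ((hHmem σ₀).mp hσ₀H) ((hHmem h).mp hh)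
    rw [← mul_smul, ← mul_smul]
    exact smul_eq_smul_of_permGal_eq W hperm P
  have hz : ∀ h ∈ H, ∃ n ∈ (galoisRepTorsion W 2).ker ⊓ κ.kerSubgroup, σ₀ * h = h * σ₀ * n := by
    intro h hh
    refine ⟨(h * σ₀)⁻¹ * (σ₀ * h), Subgroup.mem_inf.mpr ⟨?_, ?_⟩, by group⟩
    · rw [mem_ker_galoisRepTorsion_two_iff]
      intro P
      rw [mul_smul, mul_smul, hcommE h hh P, ← mul_smul h σ₀, inv_smul_smul]
    · rw [ZpExtension.mem_kerSubgroup] at hκ ⊢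
      rw [map_mul, map_inv, map_mul, map_mul, hκ, mul_one, one_mul, inv_mul_cancel]
  have hcomm : ∀ h ∈ H, ∀ x : (W.torsionGaloisModule (2 : ℤ)).toTopRep,
      (W.torsionGaloisModule (2 : ℤ)).toTopRep.ρ σ₀ ((W.torsionGaloisModule (2 : ℤ)).toTopRep.ρ h x) =
        (W.torsionGaloisModule (2 : ℤ)).toTopRep.ρ h ((W.torsionGaloisModule (2 : ℤ)).toTopRep.ρ σ₀ x) :=
    fun h hh x => hcommE h hh x
  -- `σ₀ − 1` is bijective on the finite `E[2]` (no non-zero fixed point)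
  haveI : Finite (geomTorsion W (2 : ℤ)) :=
    WeierstrassCurve.finite_torsionPoints_holds W (AlgebraicClosure ℚ) (by norm_num)
  have hbij : Bijective fun x : (W.torsionGaloisModule (2 : ℤ)).toTopRep =>
      (W.torsionGaloisModule (2 : ℤ)).toTopRep.ρ σ₀ x - x := by
    have hinj : Injective fun x : geomTorsion W (2 : ℤ) => σ₀ • x - x := by
      intro x y hxy
      by_contra hne
      refine hσ₀ (x - y) (sub_ne_zero.mpr hne) ?_
      rw [smul_sub]
      exact sub_eq_sub_iff_sub_eq_sub.mp hxy
    exact ⟨hinj, Finite.injective_iff_surjective.mp hinj⟩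
  exact SahRelNormal.oneCocycleClass_eq_zero_of_forall_mem_eq_zero_of_normal δ _ H hHnormal hNH hN hσ₀H hz
    hcomm hbij

/-- **Steinberg–Sah for `E[2]`, vanishing form, for the cyclotomic tower and either sign of `Δ`** (`ρ̄_{W,2}` onto,
`2Δ ∉ ℚ^{×2}`). [cite: Sah1968, Prop. 2.7 (b) and its proof, p. 60] [cite: Serre1972, §2.6] -/
theorem torsion_two_oneCocycleClass_eq_zero_of_forall_mem_eq_zero_of_isCyclotomic (hκ : κ.IsCyclotomic)
    (h2 : W.HasSurjectiveModNGaloisRep 2) (hΔ : ¬ IsSquare (2 * W.Δ))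
    (δ : contOneCocycles (W.torsionGaloisModule (2 : ℤ)).toTopRep)
    (hN : ∀ ν ∈ (galoisRepTorsion W 2).ker ⊓ κ.kerSubgroup, δ.1 ν = 0) :
    oneCocycleClass _ δ = 0 := by
  obtain ⟨σ₀, hσκ, hσ₀⟩ := exists_mem_kerSubgroup_noFixedPoint_of_isCyclotomic W κ hκ h2 hΔ
  exact torsion_two_oneCocycleClass_eq_zero_of_forall_mem_eq_zero_of_noFixedPoint W κ hσκ hσ₀ δ hN

/-- **Steinberg–Sah on `𝒯_J(E)` at `p = 2`, injectivity form, cyclotomic tower, either sign of `Δ`.**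
[cite: Sah1968, Prop. 2.7 (b) and its proof, p. 60] [cite: Serre1972, §2.6] -/
theorem modPTwist_two_oneCocycleClass_eq_of_forall_mem_eq_of_isCyclotomic (hκ : κ.IsCyclotomic)
    (h2 : W.HasSurjectiveModNGaloisRep 2) (hΔ : ¬ IsSquare (2 * W.Δ)) (J : ℕ)
    (φ ψ : contOneCocycles (W.modPTwist 2 κ J).toTopRep)
    (hN : ∀ ν ∈ (galoisRepTorsion W 2).ker ⊓ κ.kerSubgroup, φ.1 ν = ψ.1 ν) :
    oneCocycleClass _ φ = oneCocycleClass _ ψ := by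
  obtain ⟨σ₀, hσκ, hσ₀⟩ := exists_mem_kerSubgroup_noFixedPoint_of_isCyclotomic W κ hκ h2 hΔ
  exact modPTwist_two_oneCocycleClass_eq_of_forall_mem_eq_of_noFixedPoint W κ hσκ hσ₀ J φ ψ hN

/-- **Vanishing form on `𝒯_J(E)`, cyclotomic tower, either sign of `Δ`.**
[cite: Sah1968, Prop. 2.7 (b) and its proof, p. 60] [cite: Serre1972, §2.6] -/
theorem modPTwist_two_oneCocycleClass_eq_zero_of_forall_mem_eq_zero_of_isCyclotomic (hκ : κ.IsCyclotomic)
    (h2 : W.HasSurjectiveModNGaloisRep 2) (hΔ : ¬ IsSquare (2 * W.Δ)) (J : ℕ)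
    (φ : contOneCocycles (W.modPTwist 2 κ J).toTopRep)
    (hN : ∀ ν ∈ (galoisRepTorsion W 2).ker ⊓ κ.kerSubgroup, φ.1 ν = 0) :
    oneCocycleClass _ φ = 0 := by
  obtain ⟨σ₀, hσκ, hσ₀⟩ := exists_mem_kerSubgroup_noFixedPoint_of_isCyclotomic W κ hκ h2 hΔ
  exact modPTwist_two_oneCocycleClass_eq_zero_of_forall_mem_eq_zero_of_noFixedPoint W κ hσκ hσ₀ J φ hN

/-- **Layer form on `𝒯_J(E)`, cyclotomic tower, either sign of `Δ`.**
[cite: Sah1968, Prop. 2.7 (b) and its proof, p. 60] [cite: Washington1997, §13.1] -/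
theorem modPTwist_two_oneCocycleClass_eq_of_forall_mem_layerSubgroup_eq_of_isCyclotomic (hκ : κ.IsCyclotomic)
    (h2 : W.HasSurjectiveModNGaloisRep 2) (hΔ : ¬ IsSquare (2 * W.Δ)) (J n : ℕ)
    (φ ψ : contOneCocycles (W.modPTwist 2 κ J).toTopRep)
    (hN : ∀ ν ∈ (galoisRepTorsion W 2).ker ⊓ κ.layerSubgroup n, φ.1 ν = ψ.1 ν) :
    oneCocycleClass _ φ = oneCocycleClass _ ψ := by
  obtain ⟨σ₀, hσκ, hσ₀⟩ := exists_mem_kerSubgroup_noFixedPoint_of_isCyclotomic W κ hκ h2 hΔ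
  exact modPTwist_two_oneCocycleClass_eq_of_forall_mem_layerSubgroup_eq_of_noFixedPoint W κ hσκ hσ₀ J n φ ψ hN

/-- **Dual-twist form on `𝒯_J(E)(χ⁻¹)`, cyclotomic tower, either sign of `Δ`.**
[cite: Sah1968, Prop. 2.7 (b) and its proof, p. 60] [cite: Washington1997, §13.1] -/
theorem invTwist_modPTwist_two_oneCocycleClass_eq_of_forall_mem_eq_of_isCyclotomic (hκ : κ.IsCyclotomic)
    (h2 : W.HasSurjectiveModNGaloisRep 2) (hΔ : ¬ IsSquare (2 * W.Δ)) (J : ℕ)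
    (φ ψ : contOneCocycles (W.modPTwist 2 κ.invTwist J).toTopRep)
    (hN : ∀ ν ∈ (galoisRepTorsion W 2).ker ⊓ κ.kerSubgroup, φ.1 ν = ψ.1 ν) :
    oneCocycleClass _ φ = oneCocycleClass _ ψ := by
  obtain ⟨σ₀, hσκ, hσ₀⟩ := exists_mem_kerSubgroup_noFixedPoint_of_isCyclotomic W κ hκ h2 hΔ
  exact invTwist_modPTwist_two_oneCocycleClass_eq_of_forall_mem_eq_of_noFixedPoint W κ hσκ hσ₀ J φ ψ hN

end Sah

end Summit.BirchSwinnertonDyer.BirchSwinnertonDyer.Theorems.SteinbergFibreAtTwo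

end
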